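import Literature.MathematicalPhysics.StatisticalMechanics.Crystallization
import HarnessLib

/-!
# Stability of the Lennard-Jones interaction (named fact)

Topic `Literature/MathematicalPhysics/StatisticalMechanics`. Named fact (sorry-free `def … : Prop`,
users take `(h : lennardJones_stable)`) for the route `AtomisticToContinuum/CrystalLocalRigidity`
(item `crys_lj_stability`, prerequisite of `crys_energy_limit`, `crys_energy_upper`,
`crys_periodic_bddBelow`), over `Literature.MathematicalPhysics.StatisticalMechanics.interactionEnergy` / `lennardJones` of
`Crystallization.lean`.

## Source

Blanc–Lewin, *The crystallization conjecture: a review*, EMS Surv. Math. Sci. 2 (2015) 255–306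
(arXiv:1504.01153), §1.3, (9)–(10) and (12): a pair potential `V` is **stable** when
`∑_{1 ≤ i < j ≤ N} V(|x_i − x_j|) ≥ −C N` for all `N` and all `x_1, …, x_N ∈ ℝ^d` (10); "`V` is
stable when `V(r) ≥ φ₁(r)` for `0 ≤ r ≤ a`, `≥ −C` for `a ≤ r ≤ b`, `≥ −φ₂(r)` for `r ≥ b`, with
`φ₁, φ₂` positive decreasing on `(0, a)`, `(b, ∞)` respectively, such that
`∫₀^a φ₁(r) r^{d−1} dr = ∞`, `∫_b^∞ φ₂(r) r^{d−1} dr < ∞`, see [Dobrushin 1964] and [Fisher–Ruelle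
1966, App. A] … **The Lennard-Jones potential (3) satisfies these conditions in dimensions `d ≤ 5`,
and it is therefore stable.**" (Ruelle, *Statistical Mechanics: Rigorous Results* (1969), §3.2,
Prop. 3.2.8 is the textbook form of the criterion.)

## Transcription

* Stated for the normalised potential `lennardJones r = r⁻¹²/12 − r⁻⁶/6` of `Crystallization.lean`
  (BL's (3) up to the scaling of lengths and energies, which preserves stability) and for
  configurations of DISTINCT points (`Function.Injective x`), the domain over which
  `groundStateEnergy` is the infimum; BL's (10) is over all `x` with the convention `V(0) = +∞`,
  under which coincident configurations are trivially admissible — restricting to injective `x` is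
  the same statement.
* All `d ≤ 5` as printed; the route uses `d = 3`. Consequence (by `le_ciInf` over the non-empty
  type of injective configurations, `d ≥ 1`): `E(N) ≥ −C N`, item `crys_lj_stability`.
-/

noncomputable section

namespace Literature.MathematicalPhysics.StatisticalMechanics

/-- **Stability of the Lennard-Jones potential in dimensions `d ≤ 5`** (Blanc–Lewin 2015, §1.3,
(10) with the Dobrushin / Fisher–Ruelle criterion (12): "The Lennard-Jones potential satisfies these
conditions in dimensions `d ≤ 5`, and it is therefore stable"). For every `d ≤ 5` there is a
constant `C` such that for every `N` and every configuration `x_1, …, x_N` of distinct points of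
`ℝ^d`, `∑_{i<j} V_LJ(|x_i − x_j|) ≥ −C N`, with `V_LJ(r) = r⁻¹²/12 − r⁻⁶/6`.
[cite: BlancLewin2015, §1.3 (10) and (12)] -/
def lennardJones_stable : Prop :=
  ∀ d : ℕ, d ≤ 5 → ∃ C : ℝ, ∀ (N : ℕ) (x : Fin N → EuclideanSpace ℝ (Fin d)),
    Function.Injective x → -(C * (N : ℝ)) ≤ interactionEnergy lennardJones x

/-- Consequence: the Lennard-Jones ground-state energy in `ℝ³` is bounded below linearly,
`E(N) ≥ −C N` (Blanc–Lewin 2015, (9)); this is item `crys_lj_stability` of the route.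
[cite: BlancLewin2015, §1.3 (9)] -/
theorem lennardJones_stable.groundStateEnergy_ge (h : lennardJones_stable) :
    ∃ C : ℝ, ∀ N : ℕ, -(C * (N : ℝ)) ≤ groundStateEnergy lennardJones 3 N := by
  obtain ⟨C, hC⟩ := h 3 (by norm_num)
  refine ⟨max C 0, fun N => ?_⟩
  -- an injective configuration of `N` points in `ℝ³` exists: `i ↦ (i : ℝ) • e₀`
  have hne : Nonempty {x : Fin N → EuclideanSpace ℝ (Fin 3) // Function.Injective x} := by
    refine ⟨⟨fun i => ((i : ℕ) : ℝ) • EuclideanSpace.single (0 : Fin 3) (1 : ℝ), ?_⟩⟩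
    intro i j hij
    have h1 : ((i : ℕ) : ℝ) • EuclideanSpace.single (0 : Fin 3) (1 : ℝ) 0 =
        ((j : ℕ) : ℝ) • EuclideanSpace.single (0 : Fin 3) (1 : ℝ) 0 := by
      simpa using congrArg (fun v : EuclideanSpace ℝ (Fin 3) => v 0) hij
    have h2 : ((i : ℕ) : ℝ) = ((j : ℕ) : ℝ) := by simpa using h1
    exact Fin.ext (by exact_mod_cast h2)
  refine le_ciInf fun x => ?_
  have hCN : C * (N : ℝ) ≤ max C 0 * (N : ℝ) :=
    mul_le_mul_of_nonneg_right (le_max_left C 0) (Nat.cast_nonneg N)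
  calc -(max C 0 * (N : ℝ)) ≤ -(C * (N : ℝ)) := neg_le_neg hCN
    _ ≤ interactionEnergy lennardJones x.1 := hC N x.1 x.2

end Literature.MathematicalPhysics.StatisticalMechanics
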